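import Literature.AlgebraicGeometry.Frobenioids.UnitTrivializationBiratCompactRlf
import Literature.AlgebraicGeometry.Frobenioids.PerfectionRational
import Literature.AlgebraicGeometry.Frobenioids.PerfectionDivisorial
import HarnessLib

/-!
# Frobenioids I, Def. 4.5 (iii)(b) along a comparison of divisor monoids — the λ-rigidity transfer in
# abstract form, and its instance at THE perfection: «`(C^un-tr)^birat` admits a Frobenius-compact object ⇒
# so does `((C^pf)^un-tr)^birat`» (Prop. 5.5 (iii), proof p. 105 ll. 11–20)

Mochizuki, *The geometry of Frobenioids I: the general theory*, Kyushu J. Math. **62** (2008)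
293–400, Def. 1.2 (iv) p. 23 (Frobenius-compact: "`O^×(C)` is commutative, `O^×(C)^pf ≠ 0`, and every element
of `Aut_C(C)` that acts on `O^×(C)^pf` via multiplication by an element `∈ ℚ_{>0}` in fact acts trivially on
`O^×(C)^pf`"), Def. 4.5 (iii)(b) p. 86 ("`(C^un-tr)^birat` admits a Frobenius-compact object"), Prop. 5.5
(iii) p. 104 ll. 36–39 with proof p. 105 ll. 11–22 ("`(C^un-tr)^birat` is of Frobenius-normalized type, so
assertion (i) may be applied to `(C^un-tr)^birat` … assertion (iii) for `C^pf` follows immediately from the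
definitions"; "since `(C^un-tr)^birat` admits a Frobenius-compact object, the same is true for
`(C^rlf)^birat`"). [cite: MochizukiFrdI2008, Prop. 5.5 (iii) p.104]

PROOF-ONLY companion (no definitions; cell abc-iut, layer L1, node `FrdI:Prop5.5(iii)`, sub-DAG rows
`FrdI:Prop5.5(iii)/P55-L06` (perfection, rationally standard) and `P55-L07c/K`; seat abc-iut-w5-d250).
Seat abc-iut-L1-t2's `UnitTrivializationBiratCompactRlf.lean` proves row (K) — the transfer of a
Frobenius-compact object from `(C^un-tr)^birat` to `((C^rlf)^un-tr)^birat` — by (1) the λ-rigidity of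
`Φ^birat(X)` in divisor form (`Birat.pnat_eq_of_isFrobeniusCompact_untrBirat`) and (2) its transfer up the
injective natural map `Φ^gp → (Φ^rlf)^gp`. This file isolates step (2) over an ABSTRACT comparison and
instantiates it at THE perfection:

* `Birat.untr_isFrobeniusCompact_of_comparison` — for a Frobenioid `C′ → F_{Φ′}`, an object `A′ ∈ Ob(C′^un-tr)`
  over `X`, an injective homomorphism `ι : Φ^gp(X) → Φ′^gp(X)` natural for the pull-backs along endomorphisms
  of `X` and carrying a subgroup `S ⊆ Φ^gp(X)` into `Φ′^birat(X)`: if `S` has a non-torsion element and is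
  λ-rigid (a base automorphism scaling every element of `S` by `p/q`, in the `∃ N`-sense, has `p = q`), then
  `(A′)^birat ∈ Ob((C′^un-tr)^birat)` is Frobenius-compact — `O^×((A′)^birat) ≅ Φ′^birat(X)` by `Div` (seat
  abc-iut-L1-d5), conjugation is `Base(f⁻¹)^*` on divisors (seats abc-iut-w4-d020 / L6-t10), and an
  automorphism scaling all units by `p/q` scales every `ι d`, `d ∈ S`, hence every `d ∈ S`;
* `Birat.exists_pow_ne_one_of_isFrobeniusCompact_untrBirat` — a Frobenius-compact `A₀^birat ∈ (C^un-tr)^birat`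
  over `X` provides a non-torsion element of `Φ^birat(X)` (the divisor of its non-torsion unit);
* **`Perfection.exists_isFrobeniusCompact_untrBirat_of_untr`** — Def. 4.5 (iii)(b) for `C^pf` FROM Def. 4.5
  (iii)(b) for `C` (print p. 105 ll. 11–20): for a Frobenioid `C` of Frobenius-isotropic type with
  `C^pf → F_{Φ^pf}` a Frobenioid (Prop. 3.2 (iii), binder `hPf` as in the slot), a Frobenius-compact object of
  `(C^un-tr)^birat` yields one of `((C^pf)^un-tr)^birat` — the instance `ι := (Φ → Φ^pf)^gp_X` (injective for
  the divisorial `Φ(X)`; natural: seat abc-iut-w4-d108's `monGpMap_perfectionOf_pullGp`; `ι(Φ^birat) ⊆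
  (Φ^pf)^birat`: `map_mem_biratSubgroup_perfection`), λ-rigidity downstairs by seat abc-iut-L1-t2's
  `pnat_eq_of_isFrobeniusCompact_untrBirat`. This is the hypothesis `hK` of seat abc-iut-w4-d108's
  `FrdI.Prop55Sub.prop55iii_pf_ratStd_primarySupp_of` supplied from "`C` of rationally standard type"
  instead of from an invariant rational function (`PerfectionFrobeniusCompactUntrBirat.lean`).
No definitions; no statement of the paper is strengthened; nothing here bears on [IUTchIII] Cor. 3.12.
-/

namespace Literature.AlgebraicGeometry.Frobenioids

open CategoryTheory Opposite

universe w v v' u u'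

namespace PreFrobenioid

variable {D : Type u} [Category.{v} D] {Φ Φ' : Dᵒᵖ ⥤ CommMonCat.{w}}
  {C' : Type u'} [Category.{v'} C'] {F' : C' ⥤ ElemFrobenioid Φ'}

open PreFrobenioidData (ofFunctor)

namespace Birat

/-! ### The transfer over an abstract comparison `ι : Φ^gp(X) → Φ′^gp(X)` -/

/-- **Upstairs half of the λ-rigidity transfer, abstract form.** Let `F′ : C′ → F_{Φ′}` be a Frobenioid,
`A′ ∈ Ob(C′^un-tr)` an object over `X`, and `ι : Φ^gp(X) → Φ′^gp(X)` an injective homomorphism, natural for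
the pull-backs along endomorphisms of `X`, carrying a subgroup `S ⊆ Φ^gp(X)` into the rational functions
`Φ′^birat(X)` of `C′` at `X`. If `S` has a non-torsion element and is λ-RIGID — an automorphism `θ` of `X`
whose pull-back scales every element of `S` by `p/q` (in the `∃ N`-sense of Def. 1.2 (iv)) has `p = q` — then
`(A′)^birat` is a Frobenius-compact object of `(C′^un-tr)^birat` (Def. 1.2 (iv) for `(C′^un-tr)^birat → F_{0_D}`):
`O^×((A′)^birat) ≅ Φ′^birat(X)` by `Div`, so it is abelian, contains the non-torsion `Div⁻¹(ι d₀)`, and an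
automorphism `f` scaling all units by `p/q` scales (through `Div`, conjugation = `Base(f⁻¹)^*`) every `ι d`,
`d ∈ S`, hence every `d ∈ S` (`ι` injective and natural) by `p/q`, so `p = q` and `f` acts trivially.
[cite: MochizukiFrdI2008, Prop. 5.5 (iii) p.104] -/
theorem untr_isFrobeniusCompact_of_comparison (hF' : IsFrobenioid F') (A' : (ofFunctor Φ' F').Untr)
    (S : Subgroup (Algebra.GrothendieckGroup (Φ.obj (op (baseObj (untrFunctor hF') A')))))
    (ι : Algebra.GrothendieckGroup (Φ.obj (op (baseObj (untrFunctor hF') A'))) →*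
      PhiGp (untrFunctor hF') A')
    (hι : Function.Injective ι)
    (hnat : ∀ (θ : baseObj (untrFunctor hF') A' ⟶ baseObj (untrFunctor hF') A')
      (d : Algebra.GrothendieckGroup (Φ.obj (op (baseObj (untrFunctor hF') A')))),
      ι (pullGp Φ θ d) = pullGp Φ' θ (ι d))
    (hsub : ∀ d ∈ S, ι d ∈ biratSubgroup F' (baseObj (untrFunctor hF') A'))
    (h0 : ∃ d₀ ∈ S, ∀ N : ℕ, 0 < N → d₀ ^ N ≠ 1)
    (hrig : ∀ (θ : baseObj (untrFunctor hF') A' ≅ baseObj (untrFunctor hF') A') (p q : ℕ+),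
      (∀ d ∈ S, ∃ N : ℕ, 0 < N ∧ pullGp Φ θ.hom d ^ ((q : ℕ) * N) = d ^ ((p : ℕ) * N)) → p = q) :
    (biratOps (isFrobenioid_untr hF') (hasBiratSquares_untr hF')).IsFrobeniusCompact
      ((toBirat (untrFunctor hF') (isFrobenioid_untr hF') (hasBiratSquares_untr hF')).obj A') := by
  -- notation
  have hFu := isFrobenioid_untr hF'
  have hsq := hasBiratSquares_untr hF'
  have hinj := divHom_untr_injective hF' A'
  have hrange := range_divHom_untr hF' A'
  -- every `ι d`, `d ∈ S`, is the divisor of a rational function at `A′`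
  have hdiv : ∀ d ∈ S, ∃ x : BiratUnits (untrFunctor hF') hFu A',
      BiratUnits.divHom hFu A' x = ι d := fun d hd => by
    have h : ι d ∈ (BiratUnits.divHom hFu A').range := by rw [hrange]; exact hsub d hd
    exact h
  -- `O^×((A′)^birat)` is commutative
  have hcomm : ∀ x y : BiratUnits (untrFunctor hF') hFu A', x * y = y * x :=
    fun x y => hinj (by rw [map_mul, map_mul, mul_comm])
  refine ⟨fun u hu u' hu' => ?_, ?_, fun f p q hpq u hu => ?_⟩
  · -- (1) commutativity of the units
    obtain ⟨x, hx⟩ := exists_toAut_eq hsq ⟨u, hu⟩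
    obtain ⟨x', hx'⟩ := exists_toAut_eq hsq ⟨u', hu'⟩
    change BiratUnits.toAut hsq x = u at hx
    change BiratUnits.toAut hsq x' = u' at hx'
    rw [← hx, ← hx', ← map_mul, hcomm, map_mul]
  · -- (2) a non-torsion unit: `Div⁻¹(ι d₀)`
    obtain ⟨d₀, hd₀, htors⟩ := h0
    obtain ⟨x₀, hx₀⟩ := hdiv d₀ hd₀
    refine ⟨BiratUnits.toAut hsq x₀, toAut_mem_unitsSubgroup x₀, fun N hN h => htors N hN (hι ?_)⟩
    have h' : x₀ ^ N = 1 := BiratUnits.toAut_injective (hsq := hsq) (by rw [map_pow, h, map_one])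
    rw [map_pow, ← hx₀, ← map_pow, h', map_one, map_one]
  · -- (3) an automorphism acting by `λ = p/q` on `O^×((A′)^birat)^pf` acts trivially
    -- the base automorphism `θ = Base(f⁻¹)` of `X`
    let θ : baseObj (untrFunctor hF') A' ≅ baseObj (untrFunctor hF') A' :=
      ⟨gpBase f.inv, gpBase f.hom, BiratUnits.gpBase_inv_comp_hom f, BiratUnits.gpBase_hom_comp_inv f⟩
    -- `θ^*` scales every `d ∈ S` by `p/q`
    have hscal : ∀ d ∈ S, ∃ N : ℕ, 0 < N ∧ pullGp Φ θ.hom d ^ ((q : ℕ) * N) = d ^ ((p : ℕ) * N) := by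
      intro d hd
      obtain ⟨x, hx⟩ := hdiv d hd
      obtain ⟨y, hy, hdy⟩ := exists_biratUnits_conj hFu hsq f x
      obtain ⟨N, hN, h⟩ := hpq _ (toAut_mem_unitsSubgroup x)
      refine ⟨N, hN, hι ?_⟩
      rw [← hy, ← map_pow, ← map_pow, ← map_pow, ← map_pow] at h
      have h' := congrArg (BiratUnits.divHom hFu A') (BiratUnits.toAut_injective h)
      rw [map_pow, map_pow, map_pow, map_pow, hdy, hx, ← pow_mul, ← pow_mul] at h'
      rw [map_pow, map_pow, hnat]
      exact h'
    have hpq' : p = q := hrig θ p q hscal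
    obtain ⟨N, hN, h⟩ := hpq u hu
    refine ⟨p * N, Nat.mul_pos p.pos hN, ?_⟩
    have e : ((f * u * f⁻¹) ^ (p : ℕ)) ^ N = ((f * u * f⁻¹) ^ (q : ℕ)) ^ N := by rw [hpq']
    rw [pow_mul, pow_mul, e]
    exact h

/-! ### Downstairs: the non-torsion rational function divisor of a Frobenius-compact `A₀^birat` -/

variable {C : Type u'} [Category.{v'} C] {F : C ⥤ ElemFrobenioid Φ} in
/-- A Frobenius-compact `A₀^birat ∈ Ob((C^un-tr)^birat)` over `X` yields a NON-TORSION element of `Φ^birat(X)`: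
the divisor of its non-torsion unit (`O^×(A₀^birat) ⥲ Φ^birat(X)` by `Div`, seat abc-iut-L1-d5).
[cite: MochizukiFrdI2008, Def. 1.2 (iv) p.23] -/
theorem exists_pow_ne_one_of_isFrobeniusCompact_untrBirat (hF : IsFrobenioid F) (A₀ : (ofFunctor Φ F).Untr)
    (hY : (biratOps (isFrobenioid_untr hF) (hasBiratSquares_untr hF)).IsFrobeniusCompact
      ((toBirat (untrFunctor hF) (isFrobenioid_untr hF) (hasBiratSquares_untr hF)).obj A₀)) :
    ∃ d₀ ∈ biratSubgroup F (baseObj (untrFunctor hF) A₀), ∀ N : ℕ, 0 < N → d₀ ^ N ≠ 1 := by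
  obtain ⟨-, ⟨u₀, hu₀, htors⟩, -⟩ := hY
  obtain ⟨x₀, hx₀⟩ := exists_toAut_eq (hasBiratSquares_untr hF) ⟨u₀, hu₀⟩
  change BiratUnits.toAut _ x₀ = u₀ at hx₀
  refine ⟨BiratUnits.divHom (isFrobenioid_untr hF) A₀ x₀,
    by rw [← range_divHom_untr hF A₀]; exact ⟨x₀, rfl⟩, fun N hN h => htors N hN ?_⟩
  have h' : x₀ ^ N = 1 := divHom_untr_injective hF A₀ (by rw [map_pow, h, map_one])
  rw [← hx₀, ← map_pow, h', map_one]

end Birat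

/-! ### The instance at THE perfection -/

namespace Perfection

variable {C : Type u'} [Category.{v'} C] {F : C ⥤ ElemFrobenioid Φ}

/-- **Def. 4.5 (iii)(b) for `C^pf` from Def. 4.5 (iii)(b) for `C`** (Prop. 5.5 (iii), proof p. 105
ll. 11–20): for a Frobenioid `C` of Frobenius-isotropic type whose perfection `C^pf → F_{Φ^pf}` is a Frobenioid
(Prop. 3.2 (iii), binder `hPf`), if `(C^un-tr)^birat` admits a Frobenius-compact object `A₀^birat` (over
`X`), then `((C^pf)^un-tr)^birat` admits one — the image of `(A₀, 1)`: the λ-rigidity of `Φ^birat(X)` (seat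
abc-iut-L1-t2's `pnat_eq_of_isFrobeniusCompact_untrBirat`) transferred up the injective natural map
`ι : Φ^gp(X) → (Φ^pf)^gp(X)` (`Φ(X)` divisorial), which carries `Φ^birat(X)` into `(Φ^pf)^birat(X)` (seat
abc-iut-w4-d108's `map_mem_biratSubgroup_perfection`). [cite: MochizukiFrdI2008, Prop. 5.5 (iii) p.104] -/
theorem exists_isFrobeniusCompact_untrBirat_of_untr (hF : IsFrobenioid F)
    (hPf : IsFrobenioid (ops hF).toFunctor) (hfi : IsOfType (IsFrobeniusIsotropic F))
    (h0 : ∃ Y₀ : Birat (untrFunctor hF) (isFrobenioid_untr hF) (hasBiratSquares_untr hF),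
      (biratOps (isFrobenioid_untr hF) (hasBiratSquares_untr hF)).IsFrobeniusCompact Y₀) :
    ∃ Y : Birat (untrFunctor hPf) (isFrobenioid_untr hPf) (hasBiratSquares_untr hPf),
      (PreFrobenioidData.ofFunctor (zeroMonoid D)
        (Birat.toElemZero (isFrobenioid_untr hPf) (hasBiratSquares_untr hPf))).IsFrobeniusCompact Y := by
  obtain ⟨Y₀, hY₀⟩ := h0
  -- downstairs: `Y₀ = A₀^birat` for the object `A₀ := Y₀` of `C^un-tr` over `X := Base(A₀)`
  let A₀ : (ofFunctor Φ F).Untr := Y₀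
  have hY : (biratOps (isFrobenioid_untr hF) (hasBiratSquares_untr hF)).IsFrobeniusCompact
      ((toBirat (untrFunctor hF) (isFrobenioid_untr hF) (hasBiratSquares_untr hF)).obj A₀) := hY₀
  let A : C := A₀.as.obj
  -- upstairs: the object `(A, 1)` of `(C^pf)^un-tr` (isotropic in `C^pf`, Prop. 3.2 (iii)), over the same `X`
  have hA : (PreFrobenioidData.ofFunctor (ops hF).monFunctor (ops hF).toFunctor).IsIsotropic
      ((toPf hF).obj A) :=
    (PreFrobenioidData.ofFunctor_isIsotropic (ops hF).toFunctor _).mpr (isOfIsotropicType_toFunctor hF hfi _)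
  let A' : (PreFrobenioidData.ofFunctor (ops hF).monFunctor (ops hF).toFunctor).Untr := { as := ⟨_, hA⟩ }
  refine ⟨(toBirat (untrFunctor hPf) (isFrobenioid_untr hPf) (hasBiratSquares_untr hPf)).obj A', ?_⟩
  -- `ι : Φ(X)^gp → (Φ(X)^pf)^gp` is injective (`Φ(X)` divisorial: `Φ(X) → Φ(X)^pf` injective, target cancellative)
  have hΦX : IsDivisorial (Φ.obj (op (baseObj F A))) := hF.isPreFrobenioid.isDivisorial (baseObj F A)
  haveI : IsCancelMul (Φ.obj (op (baseObj F A))) :=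
    isIntegral_iff_isCancelMul.mp hΦX.isPreDivisorial.isIntegral
  have hc : IsCancelMul (Frobenioids.Perfection (Φ.obj (op (baseObj F A)))) := Frobenioids.Perfection.isCancelMul
  have hι : Function.Injective (MonGp.map (Frobenioids.Perfection.of (Φ.obj (op (baseObj F A))))) :=
    @MonGp.map_injective _ _ _ _ hc _ (of_injective_of_isSharp_isIntegral_isSaturated
      hΦX.isSharp hΦX.isPreDivisorial.isIntegral hΦX.isPreDivisorial.isSaturated)
  exact Birat.untr_isFrobeniusCompact_of_comparison (Φ := Φ) hPf A' (biratSubgroup F (baseObj F A))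
    (MonGp.map (Frobenioids.Perfection.of (Φ.obj (op (baseObj F A))))) hι
    (fun θ d => monGpMap_perfectionOf_pullGp hF θ d)
    (fun d hd => map_mem_biratSubgroup_perfection hF (baseObj F A) hd)
    (Birat.exists_pow_ne_one_of_isFrobeniusCompact_untrBirat hF A₀ hY)
    (fun θ p q h => Birat.pnat_eq_of_isFrobeniusCompact_untrBirat hF A₀ hY θ p q h)

end Perfection

end PreFrobenioid

end Literature.AlgebraicGeometry.Frobenioids
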